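import Summits.CriticalPhenomena.PercolationContinuityZ3.Theorems.PercNearOneGluingNoHeavyQuantForestData
import Summits.CriticalPhenomena.PercolationContinuityZ3.Theorems.PercNearOneGluingNoHeavyQuantSiblingStepAtoms
import HarnessLib

/-!
# QUANT lane R8, T-DEC: PERMUTATION INVARIANCE OF THE FOREST LAW — `flaw`, `ftop`, `fmean` (and the functionals `sigmaR`, `sigmaM`, `qmin`)
# do not depend on the order of the sibling list; `flaw (J ++ K) = flaw K ∗ flaw J`

builds on p205010 (kernel theorem, internal audit signed; external expert review pending)

Support file (`--supports stmt-CriticalPhenomena-4575`), QUANT lane typer seat prim-quant-stmt (gen 39), rung R8 of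
`run/shared/lean/prim/quant/LADDER.md`.  Theorems only, standard axioms, no sorries.  Infrastructure for typer g39's list binder
(`…QuantForestData` ✓ p396899, `…QuantForestBridge`): certificate families that treat the siblings ASYMMETRICALLY (a hub, a pair + a single —
arm-1 g46's identity I, the two-root identity, …) are stated for a convenient order of the list; since the list delivered by
`exists_list_of_compForestN` comes in derivation order, they are applied through these invariances.

* `ftop_perm`, `fmean_perm`, `sigmaR_perm`, `sigmaM_perm`, `qmin_perm` (sums / minima over the list);
* **`flaw_perm : L ~ L' → flaw L = flaw L'`** (adjacent swap = `lconv_right_comm` of `…QuantSiblingStepAtoms`);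
* **`flaw_append : flaw (J ++ K) = lconv (ftop K) (ftop J) (flaw K) (flaw J)`** (a forest is the convolution of any two complementary groups
  of its siblings — the entry point for group-splitting certificates), `ftop_append`.

HONEST STATUS: bookkeeping; `SiblingStep`, `GateStepN`, `FarTreeRow` OPEN; RATE class log\* / honest sentence unchanged.
[this work].  Nothing here is cited as a published result.  The gluing rows served [cite: KozmaNitzan2024, Conjecture 3 (p. 15)]; product
measure [cite: Grimmett1999, §1.3 p. 10].
-/

noncomputable section

namespace Summit.CriticalPhenomena.PercolationContinuityZ3.Theorems
namespace Quant
namespace LawDec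

/-- `ftop` is a sum over the list, hence permutation invariant. [this work] -/
theorem ftop_perm {L L' : List Sib} (h : L.Perm L') : ftop L = ftop L' := by
  induction h with
  | nil => rfl
  | cons s _ ih => simp only [ftop, ih]
  | swap s t L => simp only [ftop]; omega
  | trans _ _ ih₁ ih₂ => exact ih₁.trans ih₂

/-- `fmean` is permutation invariant. [this work] -/
theorem fmean_perm {L L' : List Sib} (h : L.Perm L') : fmean L = fmean L' := by
  induction h with
  | nil => rfl
  | cons s _ ih => simp only [fmean, ih]
  | swap s t L => simp only [fmean]; ring
  | trans _ _ ih₁ ih₂ => exact ih₁.trans ih₂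

/-- `sigmaR` is permutation invariant. [this work] -/
theorem sigmaR_perm {L L' : List Sib} (h : L.Perm L') : sigmaR L = sigmaR L' := by
  induction h with
  | nil => rfl
  | cons s _ ih => simp only [sigmaR, ih]
  | swap s t L => simp only [sigmaR]; ring
  | trans _ _ ih₁ ih₂ => exact ih₁.trans ih₂

/-- `sigmaM` is permutation invariant. [this work] -/
theorem sigmaM_perm {L L' : List Sib} (h : L.Perm L') : sigmaM L = sigmaM L' := by
  induction h with
  | nil => rfl
  | cons s _ ih => simp only [sigmaM, ih]
  | swap s t L => simp only [sigmaM]; ring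
  | trans _ _ ih₁ ih₂ => exact ih₁.trans ih₂

/-- `qmin` is permutation invariant. [this work] -/
theorem qmin_perm {L L' : List Sib} (h : L.Perm L') : qmin L = qmin L' := by
  induction h with
  | nil => rfl
  | cons s _ ih => simp only [qmin, ih]
  | swap s t L => simp only [qmin]; rw [← min_assoc, min_comm t.q s.q, min_assoc]
  | trans _ _ ih₁ ih₂ => exact ih₁.trans ih₂

/-- **the forest law is permutation invariant** (independent sum of the siblings in any order). [this work] -/
theorem flaw_perm {L L' : List Sib} (h : L.Perm L') : flaw L = flaw L' := by
  induction h with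
  | nil => rfl
  | cons s hp ih => simp only [flaw, ih, ftop_perm hp]
  | swap s t L =>
    simp only [flaw, ftop]
    exact lconv_right_comm (ftop L) s.M t.M (flaw L) (gate s.ρ s.q) (gate t.ρ t.q)
  | trans _ _ ih₁ ih₂ => exact ih₁.trans ih₂

/-- `ftop (J ++ K) = ftop K + ftop J`. [this work] -/
theorem ftop_append (J K : List Sib) : ftop (J ++ K) = ftop K + ftop J := by
  induction J with
  | nil => simp [ftop]
  | cons s J ih => simp only [List.cons_append, ftop, ih]; omega

/-- **a forest is the convolution of two complementary groups of its siblings**: `flaw (J ++ K) = flaw K ∗ flaw J` (with the top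
indices), for law-valid siblings in `J`. [this work] -/
theorem flaw_append (J K : List Sib) (hJ : ∀ s ∈ J, s.LawOK) (hK : ∀ s ∈ K, s.LawOK) :
    flaw (J ++ K) = lconv (ftop K) (ftop J) (flaw K) (flaw J) := by
  induction J with
  | nil =>
    obtain ⟨_, hKM, _, _⟩ := flaw_facts K hK
    simp only [List.nil_append, flaw, ftop]
    exact (funext fun h => lconv_delta_right (ftop K) 0 (flaw K) hKM h).symm
  | cons s J ih =>
    have ih' := ih (fun t ht => hJ t (List.mem_cons_of_mem s ht))
    simp only [List.cons_append, flaw, ih', ftop_append]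
    exact (lconv_assoc (ftop K) (ftop J) s.M (flaw K) (flaw J) (gate s.ρ s.q)).symm

end LawDec
end Quant
end Summit.CriticalPhenomena.PercolationContinuityZ3.Theorems
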